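import Summits.ResolutionOfSingularities.ResolutionOfSingularities.Theorems.FRationalModification.Negative.LoadBearing
import Literature.AlgebraicGeometry.Resolution.ResolutionOfSingularities
import Literature.AlgebraicGeometry.Resolution.ComponentGluing
import Mathlib.AlgebraicGeometry.Morphisms.Proper
import HarnessLib

/-!
# `FRationalModification` — a resolution witnesses the open stub `stub_isolateDefect`

Support lemma for crux `stmt-ResolutionOfSingularities-15316`
(`Summit.ResolutionOfSingularities.ResolutionOfSingularities.Theses.FrobeniusLadder.FRationalModification`,
route FrobeniusLadder), line `socle-discrepancy-certificate`, skeleton v3.1. The line's global open stub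
`stub_isolateDefect` says: every integral separated finite-type rung-2 `Y/k` (`char k = p` prime) has a
proper birational model `ρ : Y' → Y` with `Y'` integral, rung-2 at every point (stalks are domains;
every system of parameters is a weakly regular sequence generating a Frobenius-closed ideal — inline),
and FINITE defect `{x | ¬ rung-3 (𝒪_{Y',x})}` (rung-3 = domain with tightly closed parameter ideals —
inline).

* `isolateDefect_of_hasResolution` — the stub is implied by the existence of a resolution of
  singularities of `Y` (hence by the summit): along a resolution `ρ : Y' → Y` every stalk of `Y'` is a
  regular local ring of characteristic `p`, hence rung-2 AND rung-3
  (`Negative.rungTwo_of_isRegularLocalRing`, `Negative.rungThree_of_isRegularLocalRing`), so the defect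
  is empty; `Y'` is integral because it is reduced (its stalks are domains) and irreducible (birational
  onto the integral `Y`, `ComponentGluing.IsBirational.irreducibleSpace`). So the stub is consistent and
  not refutable short of `¬ResolutionOfSingularities`, exactly as
  `IntegralForm.integralModel_of_hasResolution` recorded for the older stub `stub_integralModel`.

* `isolatedDefectModel_of_hasResolution` — the same for the v4 form of the stub (extra conjunct: every proper
  generization of a defect point is regular; along a resolution every stalk is regular).

No definition is declared; the statements are written inline in the route file's vocabulary.

## Sources
* H. Matsumura, *Commutative Ring Theory*, Thm. 17.4 (iii), 14.3 (regular ⇒ Cohen–Macaulay domain; in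
  tree through `Negative.rungTwo_of_isRegularLocalRing`).
* C. Huneke, I. Swanson, *Integral closure of ideals, rings, and modules*, Thm. 13.1.2 (6) (ideals of a
  regular ring are tightly closed; in tree through `Negative.rungThree_of_isRegularLocalRing`).
* The Stacks Project, Tag 01RN (birational morphisms; in tree `IsBirational`).
-/

-- single-problem summit: the doubled namespace component `ResolutionOfSingularities` is forced
set_option linter.dupNamespace false

noncomputable section

open CategoryTheory AlgebraicGeometry IsLocalRing
open Literature.AlgebraicGeometry.Resolution
open Summit.ResolutionOfSingularities.ResolutionOfSingularities.Theses.FrobeniusLadder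

namespace Summit.ResolutionOfSingularities.ResolutionOfSingularities.Theorems.FRationalModification.IsolateDefectOfHasResolution

/-- The source of a birational morphism onto an integral scheme is integral as soon as its stalks are
domains: it is reduced (`isReduced_of_isReduced_stalk`) and irreducible
(`ComponentGluing.IsBirational.irreducibleSpace`). [folklore] -/
theorem isIntegral_of_isBirational_of_isDomain_stalk {Y' Y : Scheme.{0}} [IsIntegral Y]
    {ρ : Y' ⟶ Y} (hρ : IsBirational ρ) (h : ∀ x : Y', IsDomain (Y'.presheaf.stalk x)) :
    IsIntegral Y' := by
  haveI : ∀ x : Y', IsDomain (Y'.presheaf.stalk x) := h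
  haveI : IsReduced Y' := isReduced_of_isReduced_stalk Y'
  haveI : IrreducibleSpace Y' := ComponentGluing.IsBirational.irreducibleSpace hρ
  exact isIntegral_of_irreducibleSpace_of_isReduced Y'

/-- **A resolution of `Y` witnesses the open stub `stub_isolateDefect`** (line
`socle-discrepancy-certificate` of crux `FRationalModification`): if the integral separated finite-type
`k`-scheme `Y` (`char k = p` prime) admits a resolution of singularities `ρ : Y' → Y`, then `ρ` is a
proper birational model with `Y'` integral whose stalks — regular local rings of characteristic `p` —
are rung-2 (Cohen–Macaulay F-injective domains: Matsumura 17.4, Fedder) and rung-3 (F-rational: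
Hochster–Huneke, every ideal of a regular ring is tightly closed), so the rung-3 defect locus is empty,
in particular finite. Hence the stub is a consequence of the summit and is not refutable short of
`¬ResolutionOfSingularities`. [folklore] -/
theorem isolateDefect_of_hasResolution (p : ℕ) [Fact p.Prime] (k : Type) [Field k] [CharP k p]
    (Y : Scheme.{0}) (g : Y ⟶ Spec (.of k)) [IsSeparated g] [LocallyOfFiniteType g] [QuasiCompact g]
    [IsIntegral Y] (hres : Scheme.HasResolution Y) : ∃ (Y' : Scheme.{0}) (ρ : Y' ⟶ Y), IsProper ρ ∧
    IsBirational ρ ∧ IsIntegral Y' ∧ (∀ y : Y', (IsDomain (Y'.presheaf.stalk y) ∧ ∀ d : ℕ,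
    ringKrullDim (Y'.presheaf.stalk y) = d → ∀ s : Fin d → (Y'.presheaf.stalk y),
    (Ideal.span (Set.range s)).radical.IsMaximal →
    RingTheory.Sequence.IsWeaklyRegular (Y'.presheaf.stalk y) (List.ofFn s) ∧
    ∀ u : (Y'.presheaf.stalk y), (∃ e : ℕ, u ^ p ^ e ∈
    Ideal.span ((fun z : (Y'.presheaf.stalk y) => z ^ p ^ e) ''
    (Ideal.span (Set.range s) : Set (Y'.presheaf.stalk y)))) → u ∈ Ideal.span (Set.range s))) ∧
    {x : Y' | ¬ (IsDomain (Y'.presheaf.stalk x) ∧ ∀ d : ℕ, ringKrullDim (Y'.presheaf.stalk x) = d →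
    ∀ s : Fin d → (Y'.presheaf.stalk x), (Ideal.span (Set.range s)).radical.IsMaximal →
    ∀ u c : (Y'.presheaf.stalk x), c ≠ 0 → (∀ e : ℕ, c * u ^ p ^ e ∈
    Ideal.span ((fun z : (Y'.presheaf.stalk x) => z ^ p ^ e) ''
    (Ideal.span (Set.range s) : Set (Y'.presheaf.stalk x)))) → u ∈ Ideal.span (Set.range s))}.Finite := by
  have hp : p.Prime := Fact.out
  obtain ⟨Y', ρ, hρ⟩ := hres
  -- every stalk of the regular model has characteristic `p`, hence is rung-2 and rung-3
  have h2 : ∀ y : Y', (IsDomain (Y'.presheaf.stalk y) ∧ ∀ d : ℕ,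
      ringKrullDim (Y'.presheaf.stalk y) = d → ∀ s : Fin d → (Y'.presheaf.stalk y),
      (Ideal.span (Set.range s)).radical.IsMaximal →
      RingTheory.Sequence.IsWeaklyRegular (Y'.presheaf.stalk y) (List.ofFn s) ∧
      ∀ u : (Y'.presheaf.stalk y), (∃ e : ℕ, u ^ p ^ e ∈
      Ideal.span ((fun z : (Y'.presheaf.stalk y) => z ^ p ^ e) ''
      (Ideal.span (Set.range s) : Set (Y'.presheaf.stalk y)))) → u ∈ Ideal.span (Set.range s)) := by
    intro y
    haveI := Negative.charP_stalk (ρ ≫ g) y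
    exact Negative.rungTwo_of_isRegularLocalRing hp _ (hρ.isRegular y)
  have h3 : ∀ x : Y', (IsDomain (Y'.presheaf.stalk x) ∧ ∀ d : ℕ,
      ringKrullDim (Y'.presheaf.stalk x) = d → ∀ s : Fin d → (Y'.presheaf.stalk x),
      (Ideal.span (Set.range s)).radical.IsMaximal →
      ∀ u c : (Y'.presheaf.stalk x), c ≠ 0 → (∀ e : ℕ, c * u ^ p ^ e ∈
      Ideal.span ((fun z : (Y'.presheaf.stalk x) => z ^ p ^ e) ''
      (Ideal.span (Set.range s) : Set (Y'.presheaf.stalk x)))) → u ∈ Ideal.span (Set.range s)) := by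
    intro x
    haveI := Negative.charP_stalk (ρ ≫ g) x
    exact Negative.rungThree_of_isRegularLocalRing hp _ (hρ.isRegular x)
  refine ⟨Y', ρ, hρ.isProper, hρ.isBirational,
    isIntegral_of_isBirational_of_isDomain_stalk hρ.isBirational fun x => (h2 x).1, h2, ?_⟩
  -- the rung-3 defect locus is empty
  have hempty : {x : Y' | ¬ (IsDomain (Y'.presheaf.stalk x) ∧ ∀ d : ℕ,
      ringKrullDim (Y'.presheaf.stalk x) = d → ∀ s : Fin d → (Y'.presheaf.stalk x),
      (Ideal.span (Set.range s)).radical.IsMaximal →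
      ∀ u c : (Y'.presheaf.stalk x), c ≠ 0 → (∀ e : ℕ, c * u ^ p ^ e ∈
      Ideal.span ((fun z : (Y'.presheaf.stalk x) => z ^ p ^ e) ''
      (Ideal.span (Set.range s) : Set (Y'.presheaf.stalk x)))) → u ∈ Ideal.span (Set.range s))} =
      (∅ : Set Y') :=
    Set.eq_empty_of_forall_notMem fun x hx => hx (h3 x)
  rw [hempty]
  exact Set.finite_empty

/-- **A resolution of `Y` also witnesses the v4 form of the stub** (`stub_isolateDefect` of skeleton v4,
line `socle-discrepancy-certificate`; registered sub-goal `isolatedDefectModel_of_hasResolution`): in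
addition to the conclusions of `isolateDefect_of_hasResolution`, the model may be taken with every proper
generization of a defect point regular — along a resolution EVERY stalk is regular, so the extra conjunct
holds outright (and the defect is empty anyway). So the v4 stub, whose isolated-singularity conjunct
absorbs the withdrawn local stub `stub_singularLocusBlowupCertificate`, is still a consequence of the
summit. [folklore] -/
theorem isolatedDefectModel_of_hasResolution
    (p : ℕ) [Fact p.Prime] (k : Type) [Field k] [CharP k p] (Y : Scheme.{0}) (g : Y ⟶ Spec (.of k))
    [IsSeparated g] [LocallyOfFiniteType g] [QuasiCompact g] [IsIntegral Y] (hres : Scheme.HasResolution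
    Y) : ∃ (Y' : Scheme.{0}) (ρ : Y' ⟶ Y), IsProper ρ ∧ IsBirational ρ ∧ IsIntegral Y' ∧ (∀ y : Y',
    (IsDomain (Y'.presheaf.stalk y) ∧ ∀ d : ℕ, ringKrullDim (Y'.presheaf.stalk y) = d → ∀ s : Fin d →
    (Y'.presheaf.stalk y), (Ideal.span (Set.range s)).radical.IsMaximal →
    RingTheory.Sequence.IsWeaklyRegular (Y'.presheaf.stalk y) (List.ofFn s) ∧ ∀ u : (Y'.presheaf.stalk
    y), (∃ e : ℕ, u ^ p ^ e ∈ Ideal.span ((fun z : (Y'.presheaf.stalk y) => z ^ p ^ e) '' (Ideal.span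
    (Set.range s) : Set (Y'.presheaf.stalk y)))) → u ∈ Ideal.span (Set.range s))) ∧ {x : Y' | ¬
    (IsDomain (Y'.presheaf.stalk x) ∧ ∀ d : ℕ, ringKrullDim (Y'.presheaf.stalk x) = d → ∀ s : Fin d →
    (Y'.presheaf.stalk x), (Ideal.span (Set.range s)).radical.IsMaximal → ∀ u c : (Y'.presheaf.stalk x),
    c ≠ 0 → (∀ e : ℕ, c * u ^ p ^ e ∈ Ideal.span ((fun z : (Y'.presheaf.stalk x) => z ^ p ^ e) ''
    (Ideal.span (Set.range s) : Set (Y'.presheaf.stalk x)))) → u ∈ Ideal.span (Set.range s))}.Finite ∧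
    (∀ x : Y', ¬ (IsDomain (Y'.presheaf.stalk x) ∧ ∀ d : ℕ, ringKrullDim (Y'.presheaf.stalk x) = d → ∀ s
    : Fin d → (Y'.presheaf.stalk x), (Ideal.span (Set.range s)).radical.IsMaximal → ∀ u c :
    (Y'.presheaf.stalk x), c ≠ 0 → (∀ e : ℕ, c * u ^ p ^ e ∈ Ideal.span ((fun z : (Y'.presheaf.stalk x)
    => z ^ p ^ e) '' (Ideal.span (Set.range s) : Set (Y'.presheaf.stalk x)))) → u ∈ Ideal.span
    (Set.range s)) → ∀ y : Y', y ⤳ x → y ≠ x → IsRegularLocalRing (Y'.presheaf.stalk y)) := by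
  -- take a resolution itself: every stalk is regular of characteristic `p`
  obtain ⟨Y'', ρ', hρ'⟩ := hres
  have hp : p.Prime := Fact.out
  refine ⟨Y'', ρ', hρ'.isProper, hρ'.isBirational,
    isIntegral_of_isBirational_of_isDomain_stalk hρ'.isBirational fun x => ?_, fun y => ?_, ?_, ?_⟩
  · haveI := Negative.charP_stalk (ρ' ≫ g) x
    exact (Negative.rungTwo_of_isRegularLocalRing hp _ (hρ'.isRegular x)).1
  · haveI := Negative.charP_stalk (ρ' ≫ g) y
    exact Negative.rungTwo_of_isRegularLocalRing hp _ (hρ'.isRegular y)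
  · refine Set.Finite.subset Set.finite_empty fun x hx => hx ?_
    haveI := Negative.charP_stalk (ρ' ≫ g) x
    exact Negative.rungThree_of_isRegularLocalRing hp _ (hρ'.isRegular x)
  · intro x _ y _ _
    exact hρ'.isRegular y

end Summit.ResolutionOfSingularities.ResolutionOfSingularities.Theorems.FRationalModification.IsolateDefectOfHasResolution

end
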